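import Literature.NumberTheory.GaloisRepresentations.LubinTateUnramifiedFrobenius
import Mathlib.RingTheory.Valuation.Integral
import HarnessLib

/-!
# `E ∩ K_π^{n+1} = F` for `E` unramified: the division polynomial stays Eisenstein over `𝒪_E`

Setting of `LubinTateUnramifiedFrobenius`: `F` a non-archimedean local field, `π` a uniformiser,
`f = πX + X^q`, `φ_{n+1} = ltPolyDiv F π n` the `π^{n+1}`-division (Eisenstein) polynomial with root
`λ_{n+1} = ltRoot π n`, `K_π^{n+1} = ltField π n = F(λ_{n+1})`, and `E ⊆ F^{nr} = maxUnramified F` a finite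
subextension of `F̄` (unramified over `F`).  The first step of the relative (unramified-base) Lubin–Tate /
Coleman tower `E·K_π^{n+1}` (de Shalit I §1.1, §2.2 with `k' ⊇ k` unramified):

* `isPrime_span_algebraMap_pi` — for `E ⊆ F^{nr}`, **`π𝒪_E` is a prime ideal** (it is the maximal ideal,
  `norm_lt_one_iff_mem_span_algebraMap_pi`);
* `algebraMap_mem_span_of_mem_maximalIdeal`, `algebraMap_pi_not_mem_span_sq` — `𝔪_F ↦ π𝒪_E`, `π ∉ (π𝒪_E)²`;
* ★ `irreducible_map_ltPolyDiv_unitBall`, `irreducible_map_ltPolyDiv_of_le_maxUnramified` — **`φ_{n+1}` is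
  Eisenstein at `π𝒪_E`, hence irreducible over `𝒪_E` and (Gauss, `𝒪_E` integrally closed with fraction
  field `E`) over `E`**;
* ★ `minpoly_ltRoot_of_le_maxUnramified`, `finrank_adjoin_ltRoot_of_le_maxUnramified` — the minimal
  polynomial of `λ_{n+1}` over `E` is still `φ_{n+1}`, so **`[E(λ_{n+1}) : E] = (q-1)q^n = [K_π^{n+1} : F]`**:
  `E` and `K_π^{n+1}` are linearly disjoint over `F`;
* `finrank_sup_ltField_of_le_maxUnramified` — `[E·K_π^{n+1} : F] = [E : F]·[K_π^{n+1} : F]`.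
* ★★ `exists_absGal_fixing_smul_ltRoot_eq`, `exists_absGal_fixing_ltAbsChar_eq` — the Galois form: every
  unit `u` is realised on `λ_{n+1}` by some `σ ∈ Gal(F̄/E)` (`σ λ_{n+1} = [u]_f λ_{n+1}`), i.e. the Lubin–Tate
  character `ltAbsChar` of level `n+1` is still onto on `Gal(F̄/E)` (`PowerBasis.lift` over `E`,
  `AlgEquiv.liftNormal` to `F̄`).
* `forall_mem_sup_ltField_smul_eq_iff`, `smul_ltRoot_eq_iff_ltAbsChar_eq_one`,
  ★★ `forall_mem_sup_ltField_smul_eq_iff_ltAbsChar_eq_one` — and its kernel on `Gal(F̄/E)` is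
  `Gal(F̄/E·K_π^{n+1})`: **`Gal(E·K_π^{n+1}/E) ≅ (𝒪_F/π^{n+1})^×`** in `Γ_F`-language.

References: E. de Shalit, *Iwasawa theory of elliptic curves with complex multiplication* (1987), Ch. I
§1.1, §1.8; J. W. S. Cassels, A. Fröhlich (eds.), *Algebraic Number Theory* (1967), Ch. VI (Serre) §3.6
Prop. 6 (proof: `φ` is Eisenstein); J.-P. Serre, *Local Fields* (1979), Ch. I §6 (Eisenstein
polynomials over a DVR; unramified base change).
-/

noncomputable section

open Polynomial

namespace Literature.NumberTheory.GaloisRepresentations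

section UnramifiedDisjoint

open GaloisRepresentations.IsNonarchimedeanLocalField LubinTate ValuativeRel Field

variable (F : Type*) [Field F] [ValuativeRel F] [TopologicalSpace F] [IsNonarchimedeanLocalField F]

attribute [local instance] ltNormUniformSpace ltNormIsUniformAddGroup rk1 nF nE fintypeResidueField

variable {F}
variable {π : 𝒪[F]} (hπ : (valuation F).IsUniformizer (π : F))
variable (E : IntermediateField F (AlgebraicClosure F)) [FiniteDimensional F E]

/-! ### `π𝒪_E` is prime for `E ⊆ F^{nr}` -/

include hπ in
/-- ★ For `E ⊆ F^{nr}` the ideal `π𝒪_E` (`=` the maximal ideal `{‖x‖ < 1}`) is prime.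
[cite: SerreLocalFields1979, Ch. IV §4 Cor. 2 to Prop. 16] -/
theorem isPrime_span_algebraMap_pi (hE : E ≤ maxUnramified F) :
    (Ideal.span {algebraMap 𝒪[F] (unitBall E) π}).IsPrime := by
  refine Ideal.isPrime_iff.mpr ⟨fun htop => ?_, fun {x y} hxy => ?_⟩
  · have h1 : (1 : unitBall E) ∈ Ideal.span {algebraMap 𝒪[F] (unitBall E) π} := htop ▸ Submodule.mem_top
    have h2 := (norm_lt_one_iff_mem_span_algebraMap_pi hπ E hE 1).mpr h1
    rw [OneMemClass.coe_one, norm_one] at h2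
    exact lt_irrefl _ h2
  · rw [← norm_lt_one_iff_mem_span_algebraMap_pi hπ E hE] at hxy ⊢
    rw [← norm_lt_one_iff_mem_span_algebraMap_pi hπ E hE]
    rw [Subring.coe_mul, norm_mul] at hxy
    by_contra h
    push Not at h
    have hx : ‖(x : E)‖ = 1 := le_antisymm ((mem_unitBall_iff E).mp x.2) h.1
    have hy : ‖(y : E)‖ = 1 := le_antisymm ((mem_unitBall_iff E).mp y.2) h.2
    rw [hx, hy, mul_one] at hxy
    exact lt_irrefl _ hxy

include hπ in
/-- `𝔪_F` maps into `π𝒪_E` (any `E`): `c ∈ 𝔪_F ⇒ π ∣ c`. [cite: deShalit1987, Ch. I §1.8] -/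
theorem algebraMap_mem_span_of_mem_maximalIdeal {c : 𝒪[F]} (hc : c ∈ 𝓂[F]) :
    algebraMap 𝒪[F] (unitBall E) c ∈ Ideal.span {algebraMap 𝒪[F] (unitBall E) π} := by
  obtain ⟨d, rfl⟩ := dvd_of_mem_maximalIdeal F hπ hc
  rw [map_mul]
  exact Ideal.mul_mem_right _ _ (Ideal.mem_span_singleton_self _)

include hπ in
/-- `π ∉ (π𝒪_E)²` (any `E`): otherwise `π = dπ²`, `dπ = 1`, `‖π‖ = 1`. [cite: deShalit1987, Ch. I §1.8] -/
theorem algebraMap_pi_not_mem_span_sq :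
    algebraMap 𝒪[F] (unitBall E) π ∉ Ideal.span {algebraMap 𝒪[F] (unitBall E) π} ^ 2 := by
  rw [Ideal.span_singleton_pow]
  intro h
  obtain ⟨d, hd⟩ := Ideal.mem_span_singleton'.mp h
  have hπ0 := algebraMap_pi_ne_zero hπ E
  have h1 : d * algebraMap 𝒪[F] (unitBall E) π = 1 := by
    have e : (d * algebraMap 𝒪[F] (unitBall E) π - 1) * algebraMap 𝒪[F] (unitBall E) π = 0 := by
      rw [sub_mul, one_mul, mul_assoc, ← pow_two, hd, sub_self]
    exact sub_eq_zero.mp ((mul_eq_zero.mp e).resolve_right hπ0)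
  have h2 : ‖((d * algebraMap 𝒪[F] (unitBall E) π : unitBall E) : E)‖ < 1 := by
    rw [Subring.coe_mul, norm_mul]
    calc ‖(d : E)‖ * ‖((algebraMap 𝒪[F] (unitBall E) π : unitBall E) : E)‖
        ≤ 1 * ‖((algebraMap 𝒪[F] (unitBall E) π : unitBall E) : E)‖ :=
          mul_le_mul_of_nonneg_right ((mem_unitBall_iff E).mp d.2) (norm_nonneg _)
      _ < 1 := by rw [one_mul]; exact norm_algebraMap_pi_lt_one hπ E
  rw [h1, OneMemClass.coe_one, norm_one] at h2
  exact lt_irrefl _ h2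

/-! ### `φ_{n+1}` is Eisenstein over `𝒪_E`, irreducible over `E` -/

include hπ in
/-- ★ **`φ_{n+1}` is irreducible over `𝒪_E`** for `E ⊆ F^{nr}` (Eisenstein at the prime `π𝒪_E`: the lower
coefficients lie in `𝔪_F𝒪_E ⊆ π𝒪_E`, the constant term `π ∉ π²𝒪_E`).
[cite: CasselsFrohlichANT1967, Ch. VI §3.6 Prop. 6 (proof)] -/
theorem irreducible_map_ltPolyDiv_unitBall (hE : E ≤ maxUnramified F) (n : ℕ) :
    Irreducible ((ltPolyDiv F π n).map (algebraMap 𝒪[F] (unitBall E))) := by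
  have hπm : π ∈ 𝓂[F] := (mem_maximalIdeal_iff_valuation_lt_one _).mpr hπ.val_lt_one
  obtain ⟨hm, hd, h0⟩ := monic_ltPolyDiv π n
  have hm' : ((ltPolyDiv F π n).map (algebraMap 𝒪[F] (unitBall E))).Monic := hm.map _
  have hq : 1 < residueFieldCard F := one_lt_residueFieldCard F
  have hpos : 0 < (residueFieldCard F - 1) * residueFieldCard F ^ n :=
    Nat.mul_pos (by omega) (pow_pos (by omega) _)
  have hP := isPrime_span_algebraMap_pi hπ E hE
  refine irreducible_of_eisenstein_criterion hP ?_ (fun k hk => ?_) ?_ ?_ hm'.isPrimitive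
  · rw [hm'.leadingCoeff]
    exact fun h => hP.ne_top (Ideal.eq_top_of_isUnit_mem _ h isUnit_one)
  · rw [degree_eq_natDegree hm'.ne_zero, hm.natDegree_map, hd, Nat.cast_lt] at hk
    rw [Polynomial.coeff_map]
    refine algebraMap_mem_span_of_mem_maximalIdeal hπ E ?_
    rw [← IsLocalRing.residue_eq_zero_iff, ← Polynomial.coeff_map, map_residue_ltPolyDiv π hπm,
      coeff_X_pow, if_neg hk.ne]
  · rw [degree_eq_natDegree hm'.ne_zero, hm.natDegree_map, hd]; exact_mod_cast hpos
  · rw [Polynomial.coeff_map, h0]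
    exact algebraMap_pi_not_mem_span_sq hπ E

/-- The two ways `𝒪[F] → 𝒪_E → E` and `𝒪[F] → F → E` of viewing `φ_{n+1}` over `E` agree. [folklore] -/
private theorem map_map_ltPolyDiv (n : ℕ) :
    ((ltPolyDiv F π n).map (algebraMap 𝒪[F] (unitBall E))).map (algebraMap (unitBall E) E) =
      ((ltPolyDiv F π n).map (algebraMap 𝒪[F] F)).map (algebraMap F E) := by
  rw [Polynomial.map_map, Polynomial.map_map]
  congr 1

include hπ in
/-- ★ **`φ_{n+1}` is irreducible over `E`** for `E ⊆ F^{nr}` (Gauss's lemma: `𝒪_E` is integrally closed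
with fraction field `E`). [cite: CasselsFrohlichANT1967, Ch. VI §3.6 Prop. 6 (proof)] -/
theorem irreducible_map_ltPolyDiv_of_le_maxUnramified (hE : E ≤ maxUnramified F) (n : ℕ) :
    Irreducible (((ltPolyDiv F π n).map (algebraMap 𝒪[F] F)).map (algebraMap F E)) := by
  have hm' : ((ltPolyDiv F π n).map (algebraMap 𝒪[F] (unitBall E))).Monic := (monic_ltPolyDiv π n).1.map _
  have h := (hm'.irreducible_iff_irreducible_map_fraction_map (K := E)).mp
    (irreducible_map_ltPolyDiv_unitBall hπ E hE n)
  rwa [map_map_ltPolyDiv E n] at h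

/-! ### Linear disjointness: `[E(λ_{n+1}) : E] = [K_π^{n+1} : F]` -/

include hπ in
/-- ★ **The minimal polynomial of `λ_{n+1}` over an unramified `E` is still `φ_{n+1}`.**
[cite: deShalit1987, Ch. I §1.1] -/
theorem minpoly_ltRoot_of_le_maxUnramified (hE : E ≤ maxUnramified F) (n : ℕ) :
    minpoly E (ltRoot π n) = ((ltPolyDiv F π n).map (algebraMap 𝒪[F] F)).map (algebraMap F E) :=
  (minpoly.eq_of_irreducible_of_monic (irreducible_map_ltPolyDiv_of_le_maxUnramified hπ E hE n)
    (by rw [Polynomial.aeval_map_algebraMap]; exact aeval_ltRoot π n)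
    (((monic_ltPolyDiv π n).1.map _).map _)).symm

include hπ in
/-- ★ **`[E(λ_{n+1}) : E] = (q - 1) q^n`** for `E ⊆ F^{nr}`: `E` and `K_π^{n+1}` are linearly disjoint over `F`.
[cite: deShalit1987, Ch. I §1.1] -/
theorem finrank_adjoin_ltRoot_of_le_maxUnramified (hE : E ≤ maxUnramified F) (n : ℕ) :
    Module.finrank E (IntermediateField.adjoin E {ltRoot π n}) =
      (residueFieldCard F - 1) * residueFieldCard F ^ n := by
  rw [IntermediateField.adjoin.finrank ((isIntegral_ltRoot π n).tower_top),
    minpoly_ltRoot_of_le_maxUnramified hπ E hE n, Polynomial.Monic.natDegree_map ((monic_ltPolyDiv π n).1.map _),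
    (monic_ltPolyDiv π n).1.natDegree_map, (monic_ltPolyDiv π n).2.1]

include hπ in
/-- `[E(λ_{n+1}) : E] = [K_π^{n+1} : F]`. [cite: deShalit1987, Ch. I §1.1] -/
theorem finrank_adjoin_ltRoot_eq_finrank_ltField (hE : E ≤ maxUnramified F) (n : ℕ) :
    Module.finrank E (IntermediateField.adjoin E {ltRoot π n}) = Module.finrank F (ltField π n) := by
  rw [finrank_adjoin_ltRoot_of_le_maxUnramified hπ E hE n, finrank_ltField π hπ n]

include hπ in
/-- ★ **`[E·K_π^{n+1} : F] = [E : F]·[K_π^{n+1} : F]`** for `E ⊆ F^{nr}` (`E·K_π^{n+1} = E ⊔ K_π^{n+1}` in `F̄`).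
[cite: deShalit1987, Ch. I §1.1] -/
theorem finrank_sup_ltField_of_le_maxUnramified (hE : E ≤ maxUnramified F) (n : ℕ) :
    Module.finrank F (E ⊔ ltField π n : IntermediateField F (AlgebraicClosure F)) =
      Module.finrank F E * Module.finrank F (ltField π n) := by
  rw [← finrank_adjoin_ltRoot_eq_finrank_ltField hπ E hE n, Module.finrank_mul_finrank]
  change Module.finrank F (E ⊔ IntermediateField.adjoin F {ltRoot π n} : IntermediateField F (AlgebraicClosure F)) = _
  rw [← IntermediateField.restrictScalars_adjoin_eq_sup]
  rfl

/-! ### Galois form: `Gal(F̄/E)` still realises every unit on `λ_{n+1}` -/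

include hπ in
/-- `minpoly_E λ_{n+1} = (minpoly_F λ_{n+1})` mapped to `E`, for `E ⊆ F^{nr}`. [cite: deShalit1987, Ch. I §1.1] -/
theorem minpoly_ltRoot_eq_map_minpoly (hE : E ≤ maxUnramified F) (n : ℕ) :
    minpoly E (ltRoot π n) = (minpoly F (ltRoot π n)).map (algebraMap F E) := by
  rw [minpoly_ltRoot_of_le_maxUnramified hπ E hE n, minpoly_ltRoot π hπ n]

include hπ in
/-- ★★ **Linear disjointness in Galois form**: for `E ⊆ F^{nr}` finite over `F`, every unit `u ∈ 𝒪_F^×`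
is realised on `λ_{n+1}` by an element of `Γ_F` FIXING `E` pointwise: there is `σ ∈ Gal(F̄/E)` with
`σ λ_{n+1} = [u]_f λ_{n+1}` (the root `[u]λ_{n+1}` of `minpoly_E λ_{n+1} = φ_{n+1}` gives an
`E`-automorphism of `E(λ_{n+1})`, lifted to the normal extension `F̄/E`).  With `ltAbsChar` this says
that the Lubin–Tate character of level `n+1` is still ONTO on `Gal(F̄/E)`.
[cite: deShalit1987, Ch. I §1.1; CasselsFrohlichANT1967, Ch. VI §3.6 Prop. 6 (b)] -/
theorem exists_absGal_fixing_smul_ltRoot_eq (hE : E ≤ maxUnramified F) (n : ℕ) (u : 𝒪[F]ˣ) :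
    ∃ σ : absoluteGaloisGroup F, (∀ x : E, σ • (x : AlgebraicClosure F) = x) ∧
      σ • ltRoot π n =
        (((ltAct hπ n (u : 𝒪[F]) (genPt hπ n) : unitBall (ltField π n)) : ltField π n) : AlgebraicClosure F) := by
  set y : ltField π n := ((ltAct hπ n (u : 𝒪[F]) (genPt hπ n) : unitBall (ltField π n)) : ltField π n) with hy
  set A : IntermediateField E (AlgebraicClosure F) := IntermediateField.adjoin E {ltRoot π n} with hA
  -- `[u]λ ∈ K_π^{n+1} ⊆ E(λ)`
  have hyA : (y : AlgebraicClosure F) ∈ A := by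
    have h1 : (y : AlgebraicClosure F) ∈ IntermediateField.restrictScalars F A := by
      rw [hA, IntermediateField.restrictScalars_adjoin_eq_sup]
      exact (le_sup_right : ltField π n ≤ E ⊔ ltField π n) y.2
    exact (IntermediateField.mem_restrictScalars F).mp h1
  have hint : IsIntegral E (ltRoot π n) := (isIntegral_ltRoot π n).tower_top
  set pb := IntermediateField.adjoin.powerBasis hint with hpb
  -- `[u]λ` is a root of `minpoly_E λ`
  have hroot : aeval (⟨(y : AlgebraicClosure F), hyA⟩ : A) (minpoly E pb.gen) = 0 := by
    rw [hpb, IntermediateField.adjoin.powerBasis_gen, IntermediateField.minpoly_gen,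
      minpoly_ltRoot_eq_map_minpoly hπ E hE n]
    apply (algebraMap A (AlgebraicClosure F)).injective
    rw [map_zero, ← Polynomial.aeval_algebraMap_apply, Polynomial.aeval_map_algebraMap]
    change aeval (algebraMap (ltField π n) (AlgebraicClosure F) y) (minpoly F (ltRoot π n)) = 0
    rw [Polynomial.aeval_algebraMap_apply, aeval_ltAct_genPt_minpoly hπ n u, map_zero]
  haveI : FiniteDimensional E A := by rw [hA]; exact IntermediateField.adjoin.finiteDimensional hint
  set φ : A →ₐ[E] A := pb.lift _ hroot with hφ
  have hφgen : φ pb.gen = ⟨(y : AlgebraicClosure F), hyA⟩ := pb.lift_gen _ hroot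
  have hbij : Function.Bijective φ :=
    ⟨φ.toRingHom.injective, LinearMap.injective_iff_surjective.mp φ.toRingHom.injective⟩
  set τ : A ≃ₐ[E] A := AlgEquiv.ofBijective φ hbij with hτ
  haveI : Normal E (AlgebraicClosure F) := Normal.tower_top_of_normal F E (AlgebraicClosure F)
  set σ' : AlgebraicClosure F ≃ₐ[E] AlgebraicClosure F := τ.liftNormal (AlgebraicClosure F) with hσ'
  refine ⟨(absoluteGaloisGroup.toAlgEquiv F).symm (σ'.restrictScalars F), fun x => ?_, ?_⟩
  · rw [absoluteGaloisGroup.toAlgEquiv_symm_apply, AlgEquiv.restrictScalars_apply]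
    exact σ'.commutes x
  · rw [absoluteGaloisGroup.toAlgEquiv_symm_apply, AlgEquiv.restrictScalars_apply]
    have h1 : ltRoot π n = algebraMap A (AlgebraicClosure F) pb.gen := by
      rw [hpb, IntermediateField.adjoin.powerBasis_gen]; rfl
    rw [h1, hσ', AlgEquiv.liftNormal_commutes, hτ, AlgEquiv.ofBijective_apply, hφgen]
    rfl

include hπ in
/-- ★ **The Lubin–Tate character of level `n+1` is onto on `Gal(F̄/E)`** for `E ⊆ F^{nr}`: every class in
`(𝒪_F/π^{n+1})^×` is `ltAbsChar σ` for some `σ ∈ Γ_F` fixing `E` pointwise.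
[cite: CasselsFrohlichANT1967, Ch. VI §3.6 Prop. 6 (b); deShalit1987, Ch. I §1.1] -/
theorem exists_absGal_fixing_ltAbsChar_eq (hE : E ≤ maxUnramified F) (n : ℕ) (u : 𝒪[F]ˣ) :
    ∃ σ : absoluteGaloisGroup F, (∀ x : E, σ • (x : AlgebraicClosure F) = x) ∧
      ((ltAbsChar hπ n σ : (𝒪[F] ⧸ Ideal.span {π ^ (n + 1)})ˣ) : 𝒪[F] ⧸ Ideal.span {π ^ (n + 1)}) =
        Ideal.Quotient.mk _ (u : 𝒪[F]) := by
  obtain ⟨σ, hσE, hσl⟩ := exists_absGal_fixing_smul_ltRoot_eq hπ E hE n u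
  refine ⟨σ, hσE, ?_⟩
  haveI := isGalois_ltField hπ n
  rw [ltAbsChar_apply, coe_ltGalChar_eq_iff]
  apply Subtype.ext; apply Subtype.ext
  apply Subtype.val_injective
  have e := hσl
  rw [absoluteGaloisGroup.smul_def] at e
  change ((mapPt _ (genPt hπ n) : unitBall (ltField π n)) : ltField π n).1 =
    (((ltAct hπ n (u : 𝒪[F]) (genPt hπ n) : unitBall (ltField π n)) : ltField π n) : AlgebraicClosure F)
  rw [coe_mapPt, AlgEquiv.restrictNormalHom_apply]
  exact e

/-! ### The kernel: `σ ∈ Gal(F̄/E)` fixes `E·K_π^{n+1}` iff it fixes `λ_{n+1}` iff `ltAbsChar σ = 1` -/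

omit [FiniteDimensional F E] in
/-- An element of `Γ_F` fixing `E` pointwise and fixing `λ_{n+1}` fixes `E·K_π^{n+1} = E ⊔ K_π^{n+1}`
pointwise (induction over `E(λ_{n+1})`), and conversely. [cite: deShalit1987, Ch. I §1.1] -/
theorem forall_mem_sup_ltField_smul_eq_iff (n : ℕ) {σ : absoluteGaloisGroup F}
    (hσE : ∀ x : E, σ • (x : AlgebraicClosure F) = x) :
    (∀ z ∈ (E ⊔ ltField π n : IntermediateField F (AlgebraicClosure F)), σ • z = z) ↔
      σ • ltRoot π n = ltRoot π n := by
  constructor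
  · intro h
    exact h _ ((le_sup_right : ltField π n ≤ E ⊔ ltField π n) (IntermediateField.mem_adjoin_simple_self F _))
  · intro h z hz
    have hz' : z ∈ IntermediateField.restrictScalars F (IntermediateField.adjoin E {ltRoot π n}) := by
      rw [IntermediateField.restrictScalars_adjoin_eq_sup]; exact hz
    rw [IntermediateField.mem_restrictScalars] at hz'
    refine IntermediateField.adjoin_induction (F := E) (s := ({ltRoot π n} : Set (AlgebraicClosure F)))
      (p := fun y _ => σ • y = y) ?_ ?_ ?_ ?_ ?_ hz'
    · rintro y hy
      rw [Set.mem_singleton_iff] at hy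
      rw [hy]; exact h
    · intro x; exact hσE x
    · intro x y _ _ hx hy; rw [smul_add, hx, hy]
    · intro x _ hx; rw [smul_inv'', hx]
    · intro x y _ _ hx hy; rw [smul_mul', hx, hy]

/-- `σ` fixes `λ_{n+1}` iff its Lubin–Tate character of level `n+1` is trivial.
[cite: CasselsFrohlichANT1967, Ch. VI §3.6 Prop. 6 (b)] -/
theorem smul_ltRoot_eq_iff_ltAbsChar_eq_one (n : ℕ) (σ : absoluteGaloisGroup F) :
    σ • ltRoot π n = ltRoot π n ↔ ltAbsChar hπ n σ = 1 := by
  haveI := isGalois_ltField hπ n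
  rw [← Units.val_eq_one, ltAbsChar_apply, ← map_one (Ideal.Quotient.mk (Ideal.span {π ^ (n + 1)})),
    coe_ltGalChar_eq_iff, ltAct_one]
  constructor
  · intro e
    apply Subtype.ext; apply Subtype.ext
    apply Subtype.val_injective
    change ((mapPt _ (genPt hπ n) : unitBall (ltField π n)) : ltField π n).1 = ltRoot π n
    rw [coe_mapPt, AlgEquiv.restrictNormalHom_apply]
    rw [absoluteGaloisGroup.smul_def] at e
    exact e
  · intro h
    have h' := congrArg (fun y : (maxNilIdeal F (ltField π n)).toIdeal =>
      (((y : unitBall (ltField π n)) : ltField π n) : AlgebraicClosure F)) h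
    simp only [coe_mapPt] at h'
    rw [absoluteGaloisGroup.smul_def]
    exact (AlgEquiv.restrictNormal_commutes (absoluteGaloisGroup.toAlgEquiv F σ) (ltField π n) _).symm.trans h'

omit [FiniteDimensional F E] in
/-- ★★ **`Gal(E·K_π^{n+1}/E) ≅ (𝒪_F/π^{n+1})^×` in `Γ_F`-language** (`E ⊆ F^{nr}` finite over `F`): on
`Gal(F̄/E) = {σ ∈ Γ_F : σ|_E = id}` the Lubin–Tate character of level `n+1` is ONTO
(`exists_absGal_fixing_ltAbsChar_eq`) and its KERNEL is `Gal(F̄/E·K_π^{n+1})`.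
[cite: deShalit1987, Ch. I §1.1; CasselsFrohlichANT1967, Ch. VI §3.6 Prop. 6 (b)] -/
theorem forall_mem_sup_ltField_smul_eq_iff_ltAbsChar_eq_one (n : ℕ) {σ : absoluteGaloisGroup F}
    (hσE : ∀ x : E, σ • (x : AlgebraicClosure F) = x) :
    (∀ z ∈ (E ⊔ ltField π n : IntermediateField F (AlgebraicClosure F)), σ • z = z) ↔
      ltAbsChar hπ n σ = 1 := by
  rw [forall_mem_sup_ltField_smul_eq_iff E n hσE, smul_ltRoot_eq_iff_ltAbsChar_eq_one hπ n σ]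

end UnramifiedDisjoint

end Literature.NumberTheory.GaloisRepresentations
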